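/-
Copyright (c) 2026. All rights reserved.
Released under Apache 2.0 license as described in the file LICENSE.
Authors: abc-iut cell, seat abc-iut-L4-t12 (discharge companion of abc-iut-L4-t9's block W2-B2).
-/
import Literature.AnabelianGeometry.AbsoluteAnabelian.AbsTopIII.BiAnabelianDiagrams
import Literature.AnabelianGeometry.AbsoluteAnabelian.RigidFunctors

/-!
# [AbsTopIII] Corollary 3.7 (v) DISCHARGED over the abstract setting: total `□`-rigidity from
# id-rigidity, and the `ℤ`-action on `𝒟*` by nexus-classes of self-equivalences

S. Mochizuki, *Topics in absolute anabelian geometry III*, Cor 3.7 (v) p. 88 (bib key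
`MochizukiAbsTopIII2015`; locators = kurims manuscript pages, lit key `paper:url-5493eb38cbb7`):
"The vertex `□` of the second row of `𝒟*` is a nexus of `Γ⃗_{𝒟*}`.  Moreover, `𝒟*` is totally
`□`-rigid, and the natural action of `ℤ` on the infinite linear oriented graph `Γ⃗_{𝒟†_{≤1}}` extends
to an action of `ℤ` on `𝒟*` by nexus-classes of self-equivalences of `𝒟*`."  Proof p. 88
(verbatim, the whole printed proof): "The proofs of the various assertions of the present
Corollary 3.7 are entirely similar to the proofs of the corresponding assertions of
Corollary 3.6."  Paraphrase (ours, not print): for assertion (v) this points to the proof of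
Corollary 3.6, (v), p. 82, which reads (verbatim) "The total `□`-rigidity in question follows
immediately from Proposition 3.2, (iv) [cf. also the final portion of Proposition 3.2, (v)].  The
remainder of assertion (v) follows immediately from the definitions." — Proposition 3.2, (iv)
being the id-rigidity of `𝒞^{MLF-sB}_{T𝔽}`, and "the remainder" being the nexus and `ℤ`-action
clauses.  (Header revised 2026-08-25: an earlier version carried a paraphrase of the p. 88
sentence inside quotation marks — referee findings K4-d2 / L7-F6; no declaration changed.)

Proof companion (no new notions; the only `def`s are the shift 1-morphism data and the iso
`log_𝒳 ≅ 𝟭`) of seat abc-iut-L4-t9's `BiAnabelianDiagrams.lean`, whose typed statements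
`BiAnabelianSetting.TotallyBoxRigidStmt`, `ShiftStmt`, `Cor_3_7_v` (nexus conjunct already proved
there: `Cor37Vertex.box_isNexus`) we PROVE for every abstract `𝔖 : BiAnabelianSetting X E N`:
* `BiAnabelianSetting.shiftStmt : 𝔖.ShiftStmt` — UNCONDITIONAL: over t9's pinned translation
  `Cor37Vertex.shift m` the nexus self-equivalences `Φ_m` have identity functors at every vertex
  (all first-row vertices carry `𝒳 ×_𝔈 𝒳` and the same edge functors `log_𝒳`, `pr_⋎`, `π_⋎`, `δ_⋎`)
  and unitor 2-cells; `Φ_0 ≅ id`, `Φ_m ∘ Φ_{m'} ≅ Φ_{m+m'}` after transport along the graph-level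
  action law (`Cor37Vertex.shift_zero/shift_comp`).  Pattern ported, with credit, from seat
  abc-iut-L4-t5's Cor 3.6 (v) companion `FrobeniusPictureMLFShift` (quiver `LFVertex`).
* `totallyBoxRigidStmt_of` — total `□`-rigidity of `𝒟*` from the id-rigidity of `𝒳 ×_𝔈 𝒳`, `𝒳`
  and the rigidity of `log_𝒳`, `pr_⋎`, `π_⋎`, `δ_⋎` (Def 3.5 (vi): the pre-nexus portion `𝒟*_{≤□}`
  = row 1, the core vertex, `□`); and `totallyBoxRigidStmt_of_lift` — from the SINGLE input
  that `𝒳` is id-rigid (Prop 3.2 (iv)) once the bi-anabelian lift datum `θ^bi` of Cor 3.7 (ii)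
  (t9's `FiberSquare.BiAnabelianLift`; p. 87, verbatim with our ellipsis: "the functoriality …
  of the “group-theoretic” algorithms of Corollary 1.10") is
  given: then `δ_𝒳` is an equivalence, so `𝒳 ×_𝔈 𝒳` is id-rigid (`isIdRigid_of_equivalence`),
  `pr_⋎`, `π_⋎` are rigid (`δ ⋙ pr = δ ⋙ π = 𝟭` with `δ` essentially surjective), `log_𝒳 ≅ 𝟭`, and
  `δ_⋎` is rigid from the id-rigidity of `𝒳` alone.
* `cor_3_7_v_of_lift : IsIdRigid X → 𝔖.Cor_3_7_v` (via t9's `cor_3_7_v_iff`).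
NOT covered (as in t9's typing): the closing compatibility sentence of (v) with `ℋ_δ` and the
families of homotopies of (i)–(iii).  Refereed pre-IUT anabelian geometry; nothing here bears on
[IUTchIII] Cor 3.12.
-/

set_option autoImplicit false

namespace Literature.AnabelianGeometry.AbsoluteAnabelian.AbsTopIII

open CategoryTheory Quiver DiagramOfCategories

universe u

/-! ## The `ℤ`-translation of `Γ⃗_{𝒟*}` as an action by morphisms of oriented graphs -/

namespace Cor37Edge

/-- Between two first-row vertices there is at most one edge (`log_𝒳`).
[cite: MochizukiAbsTopIII2015, Cor 3.7 p.86] -/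
theorem eq_of_first_first {a b : ℤ} : ∀ e e' : Cor37Edge.{u} (.first a) (.first b), e = e'
  | .log _ _ _, .log _ _ _ => rfl

/-- From a first-row vertex to `□` there is exactly the edge `pr_⋎`.
[cite: MochizukiAbsTopIII2015, Cor 3.7 p.86] -/
theorem eq_of_first_box {a : ℤ} : ∀ e e' : Cor37Edge.{u} (.first a) .box, e = e'
  | .pr _, .pr _ => rfl

/-- From a first-row vertex to the core vertex there is exactly the edge `π_⋎`.
[cite: MochizukiAbsTopIII2015, Cor 3.7 (i) p.87] -/
theorem eq_of_first_ref {a : ℤ} : ∀ e e' : Cor37Edge.{u} (.first a) .ref, e = e'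
  | .proj _, .proj _ => rfl

/-- From the core vertex to a first-row vertex there is exactly the telecore edge `δ_⋎`.
[cite: MochizukiAbsTopIII2015, Cor 3.7 (ii) p.87] -/
theorem eq_of_ref_first {a : ℤ} : ∀ e e' : Cor37Edge.{u} .ref (.first a), e = e'
  | .diag _, .diag _ => rfl

end Cor37Edge

namespace Cor37Vertex

/-- The graph-level action law: `shift j` followed by `shift k` is `shift (j + k)`, as an equality
of morphisms of oriented graphs. [cite: MochizukiAbsTopIII2015, Cor 3.7 (v) p.88] -/
theorem shift_comp (j k : ℤ) : shift.{u, u} j ⋙q shift.{u, u} k = shift.{u, u} (j + k) := by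
  refine Prefunctor.ext (fun a => shiftObj_add j k a) (fun a b e => ?_)
  cases e <;>
    first
      | rfl
      | exact Cor37Edge.eq_of_first_first _ _
      | exact Cor37Edge.eq_of_first_box _ _
      | exact Cor37Edge.eq_of_first_ref _ _
      | exact Cor37Edge.eq_of_ref_first _ _

/-- `shift 0` is the identity morphism of oriented graphs. [cite: MochizukiAbsTopIII2015, Cor 3.7 (v) p.88] -/
theorem shift_zero : shift.{u, u} 0 = 𝟭q Cor37Vertex := by
  refine Prefunctor.ext (fun a => shiftObj_zero a) (fun a b e => ?_)
  cases e <;>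
    first
      | rfl
      | exact Cor37Edge.eq_of_first_first _ _
      | exact Cor37Edge.eq_of_first_box _ _
      | exact Cor37Edge.eq_of_first_ref _ _
      | exact Cor37Edge.eq_of_ref_first _ _

/-- `shift m ⋙ shift (-m) = id`. [cite: MochizukiAbsTopIII2015, Cor 3.7 (v) p.88] -/
theorem shift_comp_neg (m : ℤ) : shift.{u, u} m ⋙q shift.{u, u} (-m) = 𝟭q Cor37Vertex := by
  rw [shift_comp, Int.add_right_neg, shift_zero]

/-- `shift (-m) ⋙ shift m = id`. [cite: MochizukiAbsTopIII2015, Cor 3.7 (v) p.88] -/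
theorem shift_neg_comp (m : ℤ) : shift.{u, u} (-m) ⋙q shift.{u, u} m = 𝟭q Cor37Vertex := by
  rw [shift_comp, Int.add_left_neg, shift_zero]

/-- The pre-nexus portion `Γ⃗_{𝒟*≤□}` (row 1, the core vertex, and `□`) is the set of vertices of
row `≤ 2`. [cite: MochizukiAbsTopIII2015, Cor 3.7 (v) p.88] -/
theorem mem_preBox_iff (a : Cor37Vertex) :
    a ∈ ({a : Cor37Vertex | a.BelowBox} ∪ {Cor37Vertex.box} : Set Cor37Vertex) ↔ a.row ≤ 2 := by
  change (a.row = 1 ∨ a = Cor37Vertex.box) ↔ a.row ≤ 2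
  cases a <;> simp [row]

end Cor37Vertex

/-! ## A transport lemma for 1-morphisms over equal morphisms of graphs -/

section Transport

variable {V : Type} [Quiver.{u} V] {D : DiagramOfCategories.{u, u, 0} V}

/-- Two 1-morphisms over EQUAL morphisms of graphs, with the same vertex functors and `eqToHom`
2-cells, are 2-isomorphic after transport (private copy of the lemma of seat abc-iut-L4-t5's
Cor 3.6 (v) companion, kept private so that the public name stays with that file).
[cite: MochizukiAbsTopIII2015, Definition 3.5 (v) p.76] -/
private theorem isomorphic_transport {F₁ F₂ : V ⥤q V} (h : F₁ = F₂) (Φ : OneMorphism F₁ D D)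
    (Ψ : OneMorphism F₂ D D) (happ : ∀ a, HEq (Φ.app a) (Ψ.app a))
    (hΦ : ∀ ⦃a b : V⦄ (e : a ⟶ b) (x : D.obj a), ∃ h', (Φ.iso e).hom.app x = eqToHom h')
    (hΨ : ∀ ⦃a b : V⦄ (e : a ⟶ b) (x : D.obj a), ∃ h', (Ψ.iso e).hom.app x = eqToHom h') :
    (h ▸ Φ).Isomorphic Ψ := by
  subst h
  have happ' : ∀ a, Φ.app a = Ψ.app a := fun a => eq_of_heq (happ a)
  change Φ.Isomorphic Ψ
  refine ⟨⟨fun a => eqToHom (happ' a), ?_⟩, fun a => ?_⟩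
  · intro a b e
    ext x
    obtain ⟨h1, e1⟩ := hΦ e x
    obtain ⟨h2, e2⟩ := hΨ e x
    simp only [NatTrans.comp_app, Functor.whiskerRight_app, Functor.whiskerLeft_app, eqToHom_app,
      eqToHom_map, e1, e2]
    exact (eqToHom_trans _ _).trans (eqToHom_trans _ _).symm
  · change IsIso (eqToHom (happ' a))
    infer_instance

end Transport

namespace BiAnabelianSetting

variable {X E N : Type u} [Category.{u} X] [Category.{u} E] [Category.{u} N]
  (𝔖 : BiAnabelianSetting X E N)

/-! ## Cor 3.7 (v): the nexus self-equivalences `Φ_m` of `𝒟*` and the `ℤ`-action -/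

/-- The functor of `Φ_m` at each vertex: the identity (every first-row vertex carries `𝒳 ×_𝔈 𝒳`).
[cite: MochizukiAbsTopIII2015, Cor 3.7 (v) p.88] -/
def shiftApp (m : ℤ) :
    ∀ a : Cor37Vertex, 𝔖.starDiagram.obj a ⥤ 𝔖.starDiagram.obj (Cor37Vertex.shiftObj m a)
  | .first _ => 𝟭 𝔖.Sq
  | .box => 𝟭 X
  | .space => 𝟭 N
  | .galois => 𝟭 E
  | .ref => 𝟭 X

/-- The 2-cells of `Φ_m`: unitors (the shifted edge carries the same functor).
[cite: MochizukiAbsTopIII2015, Cor 3.7 (v) p.88] -/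
def shiftIso (m : ℤ) : ∀ {a b : Cor37Vertex} (e : Cor37Edge.{u} a b),
    𝔖.shiftApp m a ⋙ 𝔖.starDiagram.map (Cor37Vertex.shiftHom m e) ≅
      𝔖.starDiagram.map e ⋙ 𝔖.shiftApp m b
  | _, _, .log _ _ _ => 𝔖.logSq.leftUnitor ≪≫ 𝔖.logSq.rightUnitor.symm
  | _, _, .pr _ => 𝔖.pr.leftUnitor ≪≫ 𝔖.pr.rightUnitor.symm
  | _, _, .lamTimes => 𝔖.lamTimes.leftUnitor ≪≫ 𝔖.lamTimes.rightUnitor.symm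
  | _, _, .lamTimesPf => 𝔖.lamTimesPf.leftUnitor ≪≫ 𝔖.lamTimesPf.rightUnitor.symm
  | _, _, .toGal => 𝔖.spaceGal.leftUnitor ≪≫ 𝔖.spaceGal.rightUnitor.symm
  | _, _, .proj _ => 𝔖.proj.leftUnitor ≪≫ 𝔖.proj.rightUnitor.symm
  | _, _, .diag _ => 𝔖.diag.leftUnitor ≪≫ 𝔖.diag.rightUnitor.symm
  | _, _, .diagBox => (𝟭 X).leftUnitor ≪≫ (𝟭 X).rightUnitor.symm

/-- The shift 1-morphism `Φ_m : 𝒟* → 𝒟*` over `Cor37Vertex.shift m` (Def 3.5 (v), (vi)).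
[cite: MochizukiAbsTopIII2015, Cor 3.7 (v) p.88] -/
def shiftMor (m : ℤ) : OneMorphism (Cor37Vertex.shift.{u, u} m) 𝔖.starDiagram 𝔖.starDiagram where
  app := 𝔖.shiftApp m
  iso e := 𝔖.shiftIso m e

/-- The vertex functors of `Φ_m` are identities. [cite: MochizukiAbsTopIII2015, Cor 3.7 (v) p.88] -/
theorem shiftApp_heq_id (m : ℤ) (a : Cor37Vertex) :
    HEq (𝔖.shiftApp m a) (𝟭 (𝔖.starDiagram.obj a)) := by
  cases a <;> exact HEq.rfl

/-- The vertex functors of `Φ_m ∘ Φ_{m'}` are those of `Φ_{m+m'}`. [cite: MochizukiAbsTopIII2015, Cor 3.7 (v) p.88] -/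
theorem shiftMor_comp_app_heq (m m' : ℤ) (a : Cor37Vertex) :
    HEq (((𝔖.shiftMor m).comp (𝔖.shiftMor m')).app a) ((𝔖.shiftMor (m + m')).app a) := by
  cases a <;> exact HEq.rfl

/-- The 2-cells of `Φ_m` have identity components. [cite: MochizukiAbsTopIII2015, Cor 3.7 (v) p.88] -/
theorem shiftMor_iso_app (m : ℤ) : ∀ ⦃a b : Cor37Vertex⦄ (e : a ⟶ b) (x : 𝔖.starDiagram.obj a),
    ∃ h, ((𝔖.shiftMor m).iso e).hom.app x = eqToHom h := by
  intro a b e x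
  cases e <;>
    exact ⟨rfl, by
      simp only [shiftMor, shiftIso, Iso.trans_hom, Iso.symm_hom, NatTrans.comp_app,
        Functor.leftUnitor_hom_app, Functor.rightUnitor_inv_app]
      erw [Category.comp_id]
      rfl⟩

/-- The 2-cells of `Φ_m ∘ Φ_{m'}` have identity components. [cite: MochizukiAbsTopIII2015, Cor 3.7 (v) p.88] -/
theorem shiftMor_comp_iso_app (m m' : ℤ) :
    ∀ ⦃a b : Cor37Vertex⦄ (e : a ⟶ b) (x : 𝔖.starDiagram.obj a),
      ∃ h, (((𝔖.shiftMor m).comp (𝔖.shiftMor m')).iso e).hom.app x = eqToHom h := by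
  intro a b e x
  obtain ⟨h1, e1⟩ := 𝔖.shiftMor_iso_app m e x
  obtain ⟨h2, e2⟩ :=
    𝔖.shiftMor_iso_app m' ((Cor37Vertex.shift m).map e) (((𝔖.shiftMor m).app a).obj x)
  refine ⟨?_, ?_⟩
  swap
  · simp only [OneMorphism.comp, Iso.trans_hom, Iso.symm_hom, NatTrans.comp_app,
      Functor.associator_hom_app, Functor.associator_inv_app, Functor.isoWhiskerLeft_hom,
      Functor.isoWhiskerRight_hom, Functor.whiskerLeft_app, Functor.whiskerRight_app, e1, e2,
      eqToHom_map]
    repeat erw [Category.id_comp]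
    repeat erw [Category.comp_id]
    exact eqToHom_trans _ _

/-- The identity 1-morphism of `𝒟*` has identity 2-cells. [cite: MochizukiAbsTopIII2015, Definition 3.5 (v) p.76] -/
private theorem id_iso_app : ∀ ⦃a b : Cor37Vertex⦄ (e : a ⟶ b) (x : 𝔖.starDiagram.obj a),
    ∃ h, ((OneMorphism.id 𝔖.starDiagram).iso e).hom.app x = eqToHom h := by
  intro a b e x
  exact ⟨rfl, by
    simp only [OneMorphism.id, Iso.trans_hom, Iso.symm_hom, NatTrans.comp_app,
      Functor.leftUnitor_hom_app, Functor.rightUnitor_inv_app]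
    erw [Category.comp_id]
    rfl⟩

/-- `Φ_m` is an equivalence of diagrams of categories (quasi-inverse `Φ_{-m}`).
[cite: MochizukiAbsTopIII2015, Cor 3.7 (v) p.88] -/
theorem shiftMor_isEquivalence (m : ℤ) : (𝔖.shiftMor m).IsEquivalence := by
  refine ⟨Cor37Vertex.shift (-m), 𝔖.shiftMor (-m), Cor37Vertex.shift_comp_neg m,
    Cor37Vertex.shift_neg_comp m, ?_, ?_⟩
  · refine isomorphic_transport _ _ _ (fun a => ?_) (𝔖.shiftMor_comp_iso_app m (-m))
      𝔖.id_iso_app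
    cases a <;> exact HEq.rfl
  · refine isomorphic_transport _ _ _ (fun a => ?_) (𝔖.shiftMor_comp_iso_app (-m) m)
      𝔖.id_iso_app
    cases a <;> exact HEq.rfl

/-- The nexus self-equivalence `Φ_m` of `𝒟*`. [cite: MochizukiAbsTopIII2015, Cor 3.7 (v) p.88] -/
def shiftEquiv (m : ℤ) : 𝔖.starDiagram.SelfEquivalence :=
  ⟨Cor37Vertex.shift m, 𝔖.shiftMor m, 𝔖.shiftMor_isEquivalence m⟩

/-- `Φ_m` is a nexus self-equivalence relative to `□` (Def 3.5 (vi): identity on the post-nexus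
portion, the pre-nexus side — row 1 and the core vertex — mapped to itself).
[cite: MochizukiAbsTopIII2015, Cor 3.7 (v) p.88] -/
theorem shiftEquiv_isNexusClass (m : ℤ) :
    (𝔖.shiftEquiv m).IsNexusClass Cor37Vertex.box {a : Cor37Vertex | a.BelowBox} where
  isNexus := Cor37Vertex.box_isNexus
  maps_pre a ha := by
    change (Cor37Vertex.shiftObj m a).row = 1
    rw [Cor37Vertex.shiftObj_row]
    exact ha
  obj_eq_of_not_mem a ha := by
    cases a <;> first | rfl | exact absurd rfl ha
  map_heq_of_not_mem a b e ha hb := by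
    cases e <;> first | exact HEq.rfl | exact absurd rfl ha
  app_heq_id a _ _ := 𝔖.shiftApp_heq_id m a
  obj_nexus := rfl
  app_nexus_iso_id := ⟨𝟭 X, HEq.rfl, ⟨Iso.refl _⟩⟩

/-- **Cor 3.7 (v), `ℤ`-action, PROVED for every setting**: `ℤ` acts on `𝒟*` by nexus-classes of
self-equivalences whose underlying morphisms of graphs are the translations `Cor37Vertex.shift m`,
with `Φ_0 ≅ id` and `Φ_m ∘ Φ_{m'} ≅ Φ_{m+m'}` up to 2-isomorphism.
[cite: MochizukiAbsTopIII2015, Cor 3.7 (v) p.88] -/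
theorem shiftStmt : 𝔖.ShiftStmt := by
  refine ⟨𝔖.shiftEquiv, fun m => rfl, 𝔖.shiftEquiv_isNexusClass, ⟨Cor37Vertex.shift_zero, ?_⟩,
    fun m m' => ⟨Cor37Vertex.shift_comp m m', ?_⟩⟩
  · exact isomorphic_transport _ _ _ (𝔖.shiftApp_heq_id 0) (𝔖.shiftMor_iso_app 0) 𝔖.id_iso_app
  · exact isomorphic_transport _ _ _ (𝔖.shiftMor_comp_app_heq m m')
      (𝔖.shiftMor_comp_iso_app m m') (𝔖.shiftMor_iso_app (m + m'))

/-! ## Cor 3.7 (v): total `□`-rigidity of `𝒟*` from id-rigidity (the reduction to Prop 3.2 (iv)) -/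

/-- **Cor 3.7 (v), total `□`-rigidity, from rigidity of the constituents**: if `𝒳 ×_𝔈 𝒳` and `𝒳`
are id-rigid and `log_𝒳`, `pr_⋎`, `π_⋎`, `δ_⋎` are rigid, then `𝒟*` is totally `□`-rigid (the
pre-nexus portion `𝒟*_{≤□}` — row 1, the core vertex, `□`; edges `log_𝒳, pr_⋎, π_⋎, δ_⋎, δ_□` — is
vertex-rigid and edge-rigid). [cite: MochizukiAbsTopIII2015, Cor 3.7 (v) p.88] -/
theorem totallyBoxRigidStmt_of (hSq : IsIdRigid 𝔖.Sq) (hX : IsIdRigid X)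
    (hlog : IsRigidFunctor 𝔖.logSq) (hpr : IsRigidFunctor 𝔖.pr) (hproj : IsRigidFunctor 𝔖.proj)
    (hdiag : IsRigidFunctor 𝔖.diag) : 𝔖.TotallyBoxRigidStmt := by
  refine ⟨Cor37Vertex.box_isNexus, ?_, ?_⟩
  · rintro ⟨a, ha⟩
    have ha' := (Cor37Vertex.mem_preBox_iff a).1 ha
    cases a with
    | first n => exact hSq
    | box => exact hX
    | ref => exact hX
    | space => exact absurd ha' (by simp [Cor37Vertex.row])
    | galois => exact absurd ha' (by simp [Cor37Vertex.row])
  · rintro ⟨a, ha⟩ ⟨b, hb⟩ e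
    have hb' := (Cor37Vertex.mem_preBox_iff b).1 hb
    change IsRigidFunctor (𝔖.starDiagram.map e)
    change Cor37Edge a b at e
    cases e with
    | log _ _ _ => exact hlog
    | pr _ => exact hpr
    | proj _ => exact hproj
    | diag _ => exact hdiag
    | diagBox => exact hX
    | lamTimes => exact absurd hb' (by simp [Cor37Vertex.row])
    | lamTimesPf => exact absurd hb' (by simp [Cor37Vertex.row])
    | toGal => exact absurd hb' (by simp [Cor37Vertex.row])

/-- `log_𝒳 = log ×_𝔈 𝒳 ≅ 𝟭` on `𝒳 ×_𝔈 𝒳`, induced by `log ≅ 𝟭` (`logIsoId`, Def 3.1 (iv) for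
`T = T𝔽`): components `(logIsoId_{A₁}, 𝟙_{A₂})`. [cite: MochizukiAbsTopIII2015, Cor 3.7 p.86] -/
def logSqIsoId : 𝔖.logSq ≅ 𝟭 𝔖.Sq :=
  NatIso.ofComponents
    (fun o => Limits.CategoricalPullback.mkIso (𝔖.logIsoId.app o.fst) (Iso.refl o.snd) (by
      change 𝔖.gal.map (𝔖.logIsoId.hom.app o.fst) ≫ o.iso.hom =
        ((𝔖.gal.map (𝔖.logIsoId.hom.app o.fst) ≫ 𝟙 _) ≫ o.iso.hom) ≫ 𝔖.gal.map (𝟙 o.snd)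
      rw [Functor.map_id]
      erw [Category.comp_id, Category.comp_id]))
    (fun {o o'} f => by
      apply Limits.CategoricalPullback.hom_ext
      · change 𝔖.log.map f.fst ≫ 𝔖.logIsoId.hom.app o'.fst = 𝔖.logIsoId.hom.app o.fst ≫ f.fst
        exact 𝔖.logIsoId.hom.naturality f.fst
      · change f.snd ≫ 𝟙 o'.snd = 𝟙 o.snd ≫ f.snd
        rw [Category.comp_id, Category.id_comp])

/-- `log_𝒳` is rigid as soon as `𝒳 ×_𝔈 𝒳` is id-rigid. [cite: MochizukiAbsTopIII2015, Cor 3.7 (v) p.88] -/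
theorem isRigidFunctor_logSq (hSq : IsIdRigid 𝔖.Sq) : IsRigidFunctor 𝔖.logSq :=
  isRigidFunctor_of_iso 𝔖.logSqIsoId.symm hSq

/-- The diagonal `δ_𝒳` is rigid as soon as `𝒳` is id-rigid (`δ ⋙ pr = δ ⋙ π = 𝟭`, and a morphism of
`𝒳 ×_𝔈 𝒳` is determined by its two components). [cite: MochizukiAbsTopIII2015, Cor 3.7 (v) p.88] -/
theorem isRigidFunctor_diag (hX : IsIdRigid X) : IsRigidFunctor 𝔖.diag := by
  refine isRigidFunctor_of_hom_app_eq_id fun α A => ?_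
  have h1 := hX.hom_app_eq_id (Functor.isoWhiskerRight α 𝔖.pr) A
  have h2 := hX.hom_app_eq_id (Functor.isoWhiskerRight α 𝔖.proj) A
  rw [Functor.isoWhiskerRight_hom, Functor.whiskerRight_app] at h1 h2
  apply Limits.CategoricalPullback.hom_ext
  · exact h1
  · exact h2

/-- With the bi-anabelian lift datum `θ^bi` (so that `δ_𝒳 : 𝒳 ⥲ 𝒳 ×_𝔈 𝒳` is an equivalence),
`𝒳 ×_𝔈 𝒳` is id-rigid as soon as `𝒳` is. [cite: MochizukiAbsTopIII2015, Cor 3.7 (v) p.88] -/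
theorem isIdRigid_sq (θ : FiberSquare.BiAnabelianLift 𝔖.gal) (hX : IsIdRigid X) :
    IsIdRigid 𝔖.Sq :=
  isIdRigid_of_equivalence θ.diagonalEquivalence.symm hX

/-- With `θ^bi`, `pr_⋎` is rigid as soon as `𝒳` is id-rigid (`δ ⋙ pr = 𝟭`, `δ` essentially
surjective). [cite: MochizukiAbsTopIII2015, Cor 3.7 (v) p.88] -/
theorem isRigidFunctor_pr (θ : FiberSquare.BiAnabelianLift 𝔖.gal) (hX : IsIdRigid X) :
    IsRigidFunctor 𝔖.pr :=
  haveI := θ.isEquivalence_diagonal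
  isRigidFunctor_of_essSurj_precomp (G := 𝔖.diag) (show IsRigidFunctor (𝔖.diag ⋙ 𝔖.pr) from hX)

/-- With `θ^bi`, `π_⋎` is rigid as soon as `𝒳` is id-rigid. [cite: MochizukiAbsTopIII2015, Cor 3.7 (v) p.88] -/
theorem isRigidFunctor_proj (θ : FiberSquare.BiAnabelianLift 𝔖.gal) (hX : IsIdRigid X) :
    IsRigidFunctor 𝔖.proj :=
  haveI := θ.isEquivalence_diagonal
  isRigidFunctor_of_essSurj_precomp (G := 𝔖.diag) (show IsRigidFunctor (𝔖.diag ⋙ 𝔖.proj) from hX)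

/-- **Cor 3.7 (v), total `□`-rigidity, PROVED from Prop 3.2 (iv)-shaped input**: given the
bi-anabelian lift datum `θ^bi` of Cor 3.7 (ii), `𝒟*` is totally `□`-rigid as soon as `𝒳` is
id-rigid — the printed reduction "follows immediately from Proposition 3.2, (iv)".
[cite: MochizukiAbsTopIII2015, Cor 3.7 (v) p.88] -/
theorem totallyBoxRigidStmt_of_lift (θ : FiberSquare.BiAnabelianLift 𝔖.gal) (hX : IsIdRigid X) :
    𝔖.TotallyBoxRigidStmt :=
  𝔖.totallyBoxRigidStmt_of (𝔖.isIdRigid_sq θ hX) hX (𝔖.isRigidFunctor_logSq (𝔖.isIdRigid_sq θ hX))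
    (𝔖.isRigidFunctor_pr θ hX) (𝔖.isRigidFunctor_proj θ hX) (𝔖.isRigidFunctor_diag hX)

/-- **Cor 3.7 (v) as typed (`Cor_3_7_v`: nexus ∧ total `□`-rigidity ∧ `ℤ`-action), PROVED** for
every bi-anabelian setting with lift datum `θ^bi` whose `𝒳` is id-rigid (Prop 3.2 (iv)).
[cite: MochizukiAbsTopIII2015, Cor 3.7 (v) p.88] -/
theorem cor_3_7_v_of_lift (θ : FiberSquare.BiAnabelianLift 𝔖.gal) (hX : IsIdRigid X) :
    𝔖.Cor_3_7_v :=
  𝔖.cor_3_7_v_iff.2 ⟨𝔖.totallyBoxRigidStmt_of_lift θ hX, 𝔖.shiftStmt⟩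

end BiAnabelianSetting

end Literature.AnabelianGeometry.AbsoluteAnabelian.AbsTopIII
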